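import Summits.HodgeConjecture.CorCM.StabiliserOrbitCriterion
import Summits.HodgeConjecture.CorCM.PointwiseConjugationCompositum
import Summits.HodgeConjecture.CorCM.ParallelShadowsCMFieldsHodge
import Literature.AlgebraicGeometry.Pohlmann1968.SeparatingCMFamilies
import HarnessLib

/-!
# A generic CM field against ANY CM field: the exact criterion for `Hg(A₀ × A₁) = Hg(A₀) × Hg(A₁)` through the orbits of
# `Aut(ℂ / x₀K₀)` on `Hom(K₁, ℂ)`, and the Hodge conjecture on the products

COR-CM (cell `pub-hodgecm2`, binder seat `b16` gen 53, count-neutral claim ORBIT-CRITERION, file F3 — CM fields and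
abelian varieties; theorems only, no definition, no named fact, no `sorry`).  NEW as stated, hence under `Summits/`.
HONEST FRAMING: unconditional statements about the Kubota–Dodson rank of pairs of CM types and about products of CM
abelian varieties; `HC_CM` is neither used nor asserted.

Number-field dress of F1/F2 (`StabiliserOrbitKernel`, `StabiliserOrbitCriterion`).  Two slots `I = {i₀, i₁}`; `K_{i₀}` a
CM field with PAIR FLIPS (for every `x : K_{i₀} → ℂ` an automorphism of `ℂ` exchanging `x, x̄` and fixing the other
embeddings — the generic CM field of its degree, `U(Φ_{i₀})` irreducible, every type nondegenerate); `K_{i₁}` ANY CM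
field; `x₀ : K_{i₀} → ℂ` a base embedding; `Stab(x₀) = Aut(ℂ / x₀(K_{i₀}))`.  ORBIT DATA: sets
`O_j ⊆ Hom(K_{i₁}, ℂ)` on which `Stab(x₀)` is transitive, separated from each other and from each other's complex
conjugates, such that every embedding `y` off `⋃_j (O_j ∪ ȳO_j)` passes the COMPOSITUM TEST of gen 48
(`PointwiseConjugationCompositum.exists_conj_smul_iff_not_le`): `y(K_{i₁}) ⊄ x₀(K_{i₀}) · y(K_{i₁}⁺)`, i.e. some
`σ ∈ Aut(ℂ)` has `σ ∘ x₀ = x̄₀`, `σ ∘ y = y` (`offOrbits_iff_forall_not_le`).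

* §1 ANY NUMBER OF ORBITS: **`cmFamilyRank_add_card_eq_iff_not_exists_orbitCoeff_of_pairFlip`** —
  `rank(Φ₀, Φ₁) + 2 = rank Φ₀ + rank Φ₁ + 1` (`Hg(A₀ × A₁) = Hg(A₀) × Hg(A₁)`) IFF there are NO rationals `c_j` with
  `u_{Φ₀}(g ∘ x₀) = Σ_j c_j Σ_{y ∈ O_j} u_{Φ₁}(g ∘ y)` for all `g ∈ Aut(ℂ)`;
  **`isNondegenerateFamily_iff_not_exists_orbitCoeff_of_pairFlip`**; `not_isNondegenerateFamily_of_orbitCoeff` (such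
  constants make the pair degenerate — no flip or orbit hypothesis).
* §2 ONE ORBIT `O`: **`isNondegenerateFamily_iff_of_pairFlip_of_orbit`** — the pair is nondegenerate IFF `Φ₁` is
  nondegenerate AND the orbit multiplicities `#{y ∈ O : g ∘ y ∈ Φ₁}` are NOT constant-unequal (`a` when `g ∘ x₀ ∈ Φ₀`,
  `b` otherwise, `a ≠ b`); rank form `cmFamilyRank_add_card_eq_iff_of_pairFlip_of_orbit`;
  `not_isNondegenerateFamily_of_orbitMultiplicities` (constant unequal multiplicities on ANY set `O` ⟹ degenerate, no
  hypothesis).  Instances: `O = {y : y ∘ j = x₀}` for a subfield `j : K_{i₀} → K_{i₁}` (gen 52's towers), `O =` the reflex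
  type in a partner of reflex type (sequel F4, all degrees).
* §3 ABELIAN VARIETIES: **`hodgeConjectureFor_prod_of_pairFlip_of_orbit`** (HC with `B• = D•` on every `A₀^a × A₁^b` under
  the one-orbit criterion, unconditionally), **`forall_prod_hodgeClassSpan_eq_iff_of_pairFlip_of_orbit`** (simple
  non-isogenous realisations: `B• = D•` on all products IFF the criterion), **`exists_exceptional_prod_of_orbitMultiplicities`**
  (constant unequal orbit multiplicities on any `O` put an exceptional Hodge class on some `A₀^a × A₁^b`), and the
  `k`-orbit forms `hodgeConjectureFor_prod_of_pairFlip_of_not_exists_orbitCoeff`, `exists_exceptional_prod_of_orbitCoeff`.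

## References

* [Gordon1999HodgeAVSurvey] B. B. Gordon, *A survey of the Hodge conjecture for abelian varieties*, §3 Theorem (Imai,
  Murty) with proof, 7.5–7.7, 9.4.3, 10.10.
* [Serre1977] J.-P. Serre, *Linear Representations of Finite Groups*, GTM 42, §7.2–7.4.
* [Lang2002] S. Lang, *Algebra*, GTM 211, V §2 Thm. 2.8, VI §1 Thm. 1.12 (extension of automorphisms; the compositum test).
* [Dodson1984] B. Dodson, *The structure of Galois groups of CM-fields*, Trans. AMS 283 (1984), §1.1, §5.1.2.
-/

noncomputable section

open CategoryTheory CategoryTheory.Limits NumberField Module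
open scoped BigOperators

namespace Summit.HodgeConjecture.CorCM

open Literature.NumberTheory.ComplexMultiplication
open Literature.AlgebraicGeometry.Motives (AbelianVariety CMType)
open Literature.AlgebraicGeometry.HodgeTheory
open Literature.AlgebraicGeometry.ComplexMultiplication (IsCMTypeRealisation)
open Literature.AlgebraicGeometry.VanGeemen1994 (hodgeClassSpan)
open Literature.AlgebraicGeometry.Pohlmann1968
open Literature.Barriers.HodgeConjecture (divisorClassesSpan)
open scoped Classical

variable {I : Type} {K : I → Type} [∀ i, Field (K i)] [∀ i, NumberField (K i)] [∀ i, IsCMField (K i)] [Fintype I]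
  [DecidableEq I] {Φ : ∀ i, CMType (K i)} {i₀ i₁ : I}

omit [∀ i, IsCMField (K i)] [DecidableEq I] in
/-- `|⊔_i Hom(K_i, ℂ)| = Σ_i [K_i : ℚ]`. [folklore] -/
private theorem card_sigma_ringHom_eq_sum₅₃ : Fintype.card ((i : I) × (K i →+* ℂ)) = ∑ i, finrank ℚ (K i) := by
  rw [Fintype.card_sigma]
  exact Finset.sum_congr rfl fun i _ => Embeddings.card (K i) ℂ

/-! ### §0 The off-orbit hypothesis is a compositum test -/

omit [Fintype I] [DecidableEq I] in
/-- **Off the orbits, pointwise partial conjugations are compositum tests** (gen 48): for every `y` off `⋃_j (O_j ∪ ȳO_j)`,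
`∃ σ, σ ∘ x₀ = x̄₀ ∧ σ ∘ y = y` IFF `y(K_{i₁}) ⊄ x₀(K_{i₀}) · y(K_{i₁}⁺)`.
[cite: Lang2002, V §2 Thm. 2.8 and VI §1 Thm. 1.12] -/
theorem offOrbits_iff_forall_not_le {κ : Type} (O : κ → Set (K i₁ →+* ℂ)) (x₀ : K i₀ →+* ℂ) :
    (∀ y : K i₁ →+* ℂ, (∀ j, y ∉ O j ∧ (starRingAut : ℂ ≃+* ℂ) • y ∉ O j) →
        ∃ σ : ℂ ≃+* ℂ, σ • x₀ = (starRingAut : ℂ ≃+* ℂ) • x₀ ∧ σ • y = y) ↔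
      ∀ y : K i₁ →+* ℂ, (∀ j, y ∉ O j ∧ (starRingAut : ℂ ≃+* ℂ) • y ∉ O j) →
        ¬ y.toRatAlgHom.fieldRange ≤
          x₀.toRatAlgHom.fieldRange ⊔ (y.comp (maximalRealSubfield (K i₁)).subtype).toRatAlgHom.fieldRange :=
  forall_congr' fun y => forall_congr' fun _ => exists_conj_smul_iff_not_le x₀ y

/-! ### §1 Any number of orbits -/

section Types

omit [DecidableEq I] in
/-- **Orbit constants make the pair degenerate** (any two CM fields, any sets `O_j`, no flips):
`u_{Φ₀}(g ∘ x₀) = Σ_j c_j Σ_{y∈O_j} u_{Φ₁}(g ∘ y)` for all `g ∈ Aut(ℂ)` forces `rank(Φ₀, Φ₁) + 2 < rank Φ₀ + rank Φ₁ + 1`.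
[cite: Gordon1999HodgeAVSurvey, §3 Theorem (proof) and 7.5] -/
theorem cmFamilyRank_add_card_lt_of_orbitCoeff (h01 : i₀ ≠ i₁) {x₀ : K i₀ →+* ℂ} {κ : Type} [Fintype κ]
    (O : κ → Set (K i₁ →+* ℂ)) {c : κ → ℚ}
    (hc : ∀ g : ℂ ≃+* ℂ, antiVec (Φ i₀).1 (1 : ℂ ≃+* ℂ) (g • x₀) =
      ∑ j, c j * ∑ y ∈ Finset.univ.filter (fun y : K i₁ →+* ℂ => y ∈ O j), antiVec (Φ i₁).1 (1 : ℂ ≃+* ℂ) (g • y)) :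
    CMAlgebra.cmFamilyRank Φ + Fintype.card I < (∑ i, cmTypeRank (Φ i)) + 1 :=
  haveI : Nonempty I := ⟨i₀⟩
  Shadow.typeRank_sigmaType_add_card_lt_of_orbitCoeff (G := ℂ ≃+* ℂ) (Φ := fun i => (Φ i).1)
    (fun i => isCMTypeWith_conj (Φ i)) h01 O hc

omit [DecidableEq I] in
/-- … hence the pair is DEGENERATE. [cite: Gordon1999HodgeAVSurvey, 7.5–7.7] -/
theorem not_isNondegenerateFamily_of_orbitCoeff (h01 : i₀ ≠ i₁) {x₀ : K i₀ →+* ℂ} {κ : Type} [Fintype κ]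
    (O : κ → Set (K i₁ →+* ℂ)) {c : κ → ℚ}
    (hc : ∀ g : ℂ ≃+* ℂ, antiVec (Φ i₀).1 (1 : ℂ ≃+* ℂ) (g • x₀) =
      ∑ j, c j * ∑ y ∈ Finset.univ.filter (fun y : K i₁ →+* ℂ => y ∈ O j), antiVec (Φ i₁).1 (1 : ℂ ≃+* ℂ) (g • y)) :
    ¬ CMAlgebra.IsNondegenerateFamily Φ :=
  not_isNondegenerateFamily_of_cmFamilyRank_add_card_lt Φ (cmFamilyRank_add_card_lt_of_orbitCoeff h01 O hc)

/-- **THE EXACT CRITERION, `k` ORBITS (rank form).**  `I = {i₀, i₁}`, `K_{i₀}` with pair flips, `K_{i₁}` ANY CM field,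
orbit data `(O_j)_j` at `x₀`: `rank(Φ₀, Φ₁) + 2 = rank Φ₀ + rank Φ₁ + 1` (`Hg(A₀ × A₁) = Hg(A₀) × Hg(A₁)`) IFF there are
NO constants `c_j ∈ ℚ` with `u_{Φ₀}(g ∘ x₀) = Σ_j c_j Σ_{y∈O_j} u_{Φ₁}(g ∘ y)` for all `g ∈ Aut(ℂ)`.
[cite: Gordon1999HodgeAVSurvey, §3 Theorem (1) and 7.5–7.7] [cite: Serre1977, §7.2–7.4] [cite: Dodson1984, §5.1.2] -/
theorem cmFamilyRank_add_card_eq_iff_not_exists_orbitCoeff_of_pairFlip (hI : ∀ i, i = i₀ ∨ i = i₁) (h01 : i₀ ≠ i₁)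
    (hflip₀ : ∀ x : K i₀ →+* ℂ, ∃ σ : ℂ ≃+* ℂ, σ • x = (starRingAut : ℂ ≃+* ℂ) • x ∧
      ∀ x' : K i₀ →+* ℂ, x' ≠ x → x' ≠ (starRingAut : ℂ ≃+* ℂ) • x → σ • x' = x')
    {x₀ : K i₀ →+* ℂ} {κ : Type} [Fintype κ] (O : κ → Set (K i₁ →+* ℂ))
    (hO : ∀ j, ∀ y ∈ O j, ∀ y' ∈ O j, ∃ g : ℂ ≃+* ℂ, g • x₀ = x₀ ∧ g • y = y')
    (hdisj : ∀ j j', j ≠ j' → ∀ y ∈ O j, y ∉ O j' ∧ (starRingAut : ℂ ≃+* ℂ) • y ∉ O j')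
    (hoff : ∀ y : K i₁ →+* ℂ, (∀ j, y ∉ O j ∧ (starRingAut : ℂ ≃+* ℂ) • y ∉ O j) →
      ∃ σ : ℂ ≃+* ℂ, σ • x₀ = (starRingAut : ℂ ≃+* ℂ) • x₀ ∧ σ • y = y) :
    CMAlgebra.cmFamilyRank Φ + Fintype.card I = (∑ i, cmTypeRank (Φ i)) + 1 ↔
      ¬ ∃ c : κ → ℚ, ∀ g : ℂ ≃+* ℂ, antiVec (Φ i₀).1 (1 : ℂ ≃+* ℂ) (g • x₀) =
        ∑ j, c j * ∑ y ∈ Finset.univ.filter (fun y : K i₁ →+* ℂ => y ∈ O j),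
          antiVec (Φ i₁).1 (1 : ℂ ≃+* ℂ) (g • y) := by
  haveI := isPretransitive_ringEquiv_complex (K := K i₀)
  haveI : Nonempty I := ⟨i₀⟩
  exact Shadow.typeRank_sigmaType_add_card_eq_iff_not_exists_orbitCoeff (G := ℂ ≃+* ℂ) (Φ := fun i => (Φ i).1)
    (fun i => isCMTypeWith_conj (Φ i)) hI h01 (antiSpan_irreducible_of_pairFlip (isCMTypeWith_conj (Φ i₀)) hflip₀)
    O hO hdisj hoff

/-- **THE EXACT CRITERION, `k` ORBITS (nondegeneracy form)**: the pair is nondegenerate IFF `Φ₁` is nondegenerate and no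
orbit constants exist. [cite: Gordon1999HodgeAVSurvey, 7.5–7.7] [cite: Dodson1984, §5.1.2] -/
theorem isNondegenerateFamily_iff_not_exists_orbitCoeff_of_pairFlip (hI : ∀ i, i = i₀ ∨ i = i₁) (h01 : i₀ ≠ i₁)
    (hflip₀ : ∀ x : K i₀ →+* ℂ, ∃ σ : ℂ ≃+* ℂ, σ • x = (starRingAut : ℂ ≃+* ℂ) • x ∧
      ∀ x' : K i₀ →+* ℂ, x' ≠ x → x' ≠ (starRingAut : ℂ ≃+* ℂ) • x → σ • x' = x')
    {x₀ : K i₀ →+* ℂ} {κ : Type} [Fintype κ] (O : κ → Set (K i₁ →+* ℂ))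
    (hO : ∀ j, ∀ y ∈ O j, ∀ y' ∈ O j, ∃ g : ℂ ≃+* ℂ, g • x₀ = x₀ ∧ g • y = y')
    (hdisj : ∀ j j', j ≠ j' → ∀ y ∈ O j, y ∉ O j' ∧ (starRingAut : ℂ ≃+* ℂ) • y ∉ O j')
    (hoff : ∀ y : K i₁ →+* ℂ, (∀ j, y ∉ O j ∧ (starRingAut : ℂ ≃+* ℂ) • y ∉ O j) →
      ∃ σ : ℂ ≃+* ℂ, σ • x₀ = (starRingAut : ℂ ≃+* ℂ) • x₀ ∧ σ • y = y) :
    CMAlgebra.IsNondegenerateFamily Φ ↔ IsNondegenerate (Φ i₁) ∧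
      ¬ ∃ c : κ → ℚ, ∀ g : ℂ ≃+* ℂ, antiVec (Φ i₀).1 (1 : ℂ ≃+* ℂ) (g • x₀) =
        ∑ j, c j * ∑ y ∈ Finset.univ.filter (fun y : K i₁ →+* ℂ => y ∈ O j),
          antiVec (Φ i₁).1 (1 : ℂ ≃+* ℂ) (g • y) := by
  haveI := isPretransitive_ringEquiv_complex (K := K i₀)
  haveI : Nonempty I := ⟨i₀⟩
  have hnd₀ : typeRank (ℂ ≃+* ℂ) (Φ i₀).1 = Fintype.card (K i₀ →+* ℂ) / 2 + 1 :=
    typeRank_eq_of_pairFlip (isCMTypeWith_conj (Φ i₀)) hflip₀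
  have key := Shadow.typeRank_sigmaType_eq_iff_not_exists_orbitCoeff (G := ℂ ≃+* ℂ) (Φ := fun i => (Φ i).1)
    (fun i => isCMTypeWith_conj (Φ i)) hI h01 (antiSpan_irreducible_of_pairFlip (isCMTypeWith_conj (Φ i₀)) hflip₀)
    hnd₀ O hO hdisj hoff
  rw [CMAlgebra.isNondegenerateFamily_iff, ← card_sigma_ringHom_eq_sum₅₃ (K := K), isNondegenerate_iff, cmTypeRank,
    ← Embeddings.card (K i₁) ℂ]
  exact key

/-! ### §2 One orbit -/

omit [DecidableEq I] in
/-- **Constant unequal orbit multiplicities make the pair degenerate** — ANY set `O ⊆ Hom(K_{i₁}, ℂ)`, any two CM fields,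
no flips: `#{y ∈ O : g ∘ y ∈ Φ₁} = a` when `g ∘ x₀ ∈ Φ₀`, `= b` otherwise, `a ≠ b` ⟹
`rank(Φ₀, Φ₁) + 2 < rank Φ₀ + rank Φ₁ + 1`. [cite: Gordon1999HodgeAVSurvey, §3 Theorem (proof), 7.5 and 9.4.3] -/
theorem cmFamilyRank_add_card_lt_of_orbitMultiplicities (h01 : i₀ ≠ i₁) {x₀ : K i₀ →+* ℂ} (O : Set (K i₁ →+* ℂ))
    {a b : ℕ} (hab : a ≠ b)
    (hN : ∀ g : ℂ ≃+* ℂ, (Finset.univ.filter fun y : K i₁ →+* ℂ => y ∈ O ∧ g • y ∈ (Φ i₁).1).card =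
      if g • x₀ ∈ (Φ i₀).1 then a else b) :
    CMAlgebra.cmFamilyRank Φ + Fintype.card I < (∑ i, cmTypeRank (Φ i)) + 1 :=
  haveI : Nonempty I := ⟨i₀⟩
  Shadow.typeRank_sigmaType_add_card_lt_of_orbitMultiplicities (G := ℂ ≃+* ℂ) (Φ := fun i => (Φ i).1)
    (fun i => isCMTypeWith_conj (Φ i)) h01 O hab hN

omit [DecidableEq I] in
/-- … hence the pair is DEGENERATE. [cite: Gordon1999HodgeAVSurvey, 7.5–7.7 and 9.4.3] -/
theorem not_isNondegenerateFamily_of_orbitMultiplicities (h01 : i₀ ≠ i₁) {x₀ : K i₀ →+* ℂ} (O : Set (K i₁ →+* ℂ))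
    {a b : ℕ} (hab : a ≠ b)
    (hN : ∀ g : ℂ ≃+* ℂ, (Finset.univ.filter fun y : K i₁ →+* ℂ => y ∈ O ∧ g • y ∈ (Φ i₁).1).card =
      if g • x₀ ∈ (Φ i₀).1 then a else b) :
    ¬ CMAlgebra.IsNondegenerateFamily Φ :=
  not_isNondegenerateFamily_of_cmFamilyRank_add_card_lt Φ (cmFamilyRank_add_card_lt_of_orbitMultiplicities h01 O hab hN)

/-- **THE ONE-ORBIT CRITERION (rank form).**  `I = {i₀, i₁}`, `K_{i₀}` with pair flips, `K_{i₁}` ANY CM field,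
`O ⊆ Hom(K_{i₁}, ℂ)` homogeneous under `Aut(ℂ / x₀K_{i₀})`, compositum test off `O ∪ Ō`:
`rank(Φ₀, Φ₁) + 2 = rank Φ₀ + rank Φ₁ + 1` (`Hg(A₀ × A₁) = Hg(A₀) × Hg(A₁)`) IFF the orbit multiplicities
`#{y ∈ O : g ∘ y ∈ Φ₁}` are NOT constant-unequal according to `g ∘ x₀ ∈ Φ₀`.
[cite: Gordon1999HodgeAVSurvey, §3 Theorem (1), 7.5–7.7 and 9.4.3] [cite: Dodson1984, §5.1.2] -/
theorem cmFamilyRank_add_card_eq_iff_of_pairFlip_of_orbit (hI : ∀ i, i = i₀ ∨ i = i₁) (h01 : i₀ ≠ i₁)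
    (hflip₀ : ∀ x : K i₀ →+* ℂ, ∃ σ : ℂ ≃+* ℂ, σ • x = (starRingAut : ℂ ≃+* ℂ) • x ∧
      ∀ x' : K i₀ →+* ℂ, x' ≠ x → x' ≠ (starRingAut : ℂ ≃+* ℂ) • x → σ • x' = x')
    {x₀ : K i₀ →+* ℂ} (O : Set (K i₁ →+* ℂ)) (hO : ∀ y ∈ O, ∀ y' ∈ O, ∃ g : ℂ ≃+* ℂ, g • x₀ = x₀ ∧ g • y = y')
    (hoff : ∀ y : K i₁ →+* ℂ, y ∉ O → (starRingAut : ℂ ≃+* ℂ) • y ∉ O →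
      ∃ σ : ℂ ≃+* ℂ, σ • x₀ = (starRingAut : ℂ ≃+* ℂ) • x₀ ∧ σ • y = y) :
    CMAlgebra.cmFamilyRank Φ + Fintype.card I = (∑ i, cmTypeRank (Φ i)) + 1 ↔
      ¬ ∃ a b : ℕ, a ≠ b ∧ ∀ g : ℂ ≃+* ℂ,
        (Finset.univ.filter fun y : K i₁ →+* ℂ => y ∈ O ∧ g • y ∈ (Φ i₁).1).card =
          if g • x₀ ∈ (Φ i₀).1 then a else b := by
  haveI := isPretransitive_ringEquiv_complex (K := K i₀)
  haveI : Nonempty I := ⟨i₀⟩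
  exact Shadow.typeRank_sigmaType_add_card_eq_iff_not_exists_orbitMultiplicities (G := ℂ ≃+* ℂ)
    (Φ := fun i => (Φ i).1) (fun i => isCMTypeWith_conj (Φ i)) hI h01
    (antiSpan_irreducible_of_pairFlip (isCMTypeWith_conj (Φ i₀)) hflip₀) O hO hoff

/-- **THE ONE-ORBIT CRITERION (nondegeneracy form)**: the pair `(Φ₀, Φ₁)` is nondegenerate IFF `Φ₁` is nondegenerate and
its orbit multiplicities on `O` are not constant-unequal. [cite: Gordon1999HodgeAVSurvey, 7.5–7.7 and 9.4.3]
[cite: Dodson1984, §5.1.2] -/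
theorem isNondegenerateFamily_iff_of_pairFlip_of_orbit (hI : ∀ i, i = i₀ ∨ i = i₁) (h01 : i₀ ≠ i₁)
    (hflip₀ : ∀ x : K i₀ →+* ℂ, ∃ σ : ℂ ≃+* ℂ, σ • x = (starRingAut : ℂ ≃+* ℂ) • x ∧
      ∀ x' : K i₀ →+* ℂ, x' ≠ x → x' ≠ (starRingAut : ℂ ≃+* ℂ) • x → σ • x' = x')
    {x₀ : K i₀ →+* ℂ} (O : Set (K i₁ →+* ℂ)) (hO : ∀ y ∈ O, ∀ y' ∈ O, ∃ g : ℂ ≃+* ℂ, g • x₀ = x₀ ∧ g • y = y')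
    (hoff : ∀ y : K i₁ →+* ℂ, y ∉ O → (starRingAut : ℂ ≃+* ℂ) • y ∉ O →
      ∃ σ : ℂ ≃+* ℂ, σ • x₀ = (starRingAut : ℂ ≃+* ℂ) • x₀ ∧ σ • y = y) :
    CMAlgebra.IsNondegenerateFamily Φ ↔ IsNondegenerate (Φ i₁) ∧
      ¬ ∃ a b : ℕ, a ≠ b ∧ ∀ g : ℂ ≃+* ℂ,
        (Finset.univ.filter fun y : K i₁ →+* ℂ => y ∈ O ∧ g • y ∈ (Φ i₁).1).card =
          if g • x₀ ∈ (Φ i₀).1 then a else b := by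
  haveI := isPretransitive_ringEquiv_complex (K := K i₀)
  haveI : Nonempty I := ⟨i₀⟩
  have key := Shadow.typeRank_sigmaType_eq_iff_of_pairFlip_of_orbit (G := ℂ ≃+* ℂ) (Φ := fun i => (Φ i).1)
    (fun i => isCMTypeWith_conj (Φ i)) hI h01 hflip₀ O hO hoff
  rw [CMAlgebra.isNondegenerateFamily_iff, ← card_sigma_ringHom_eq_sum₅₃ (K := K), isNondegenerate_iff, cmTypeRank,
    ← Embeddings.card (K i₁) ℂ]
  exact key

end Types

/-! ### §3 Abelian varieties -/

section Varieties

variable [Nonempty I] {A : I → AbelianVariety ℂ} {ι : ∀ i, 𝓞 (K i) →+* End (A i)}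
  {θ : ∀ i, K i →+* Module.End ℂ (complexBetti (A i).X 1)}

/-- **The Hodge conjecture on every `A₀^a × A₁^b`** (every `⨁_{j<N} A_{π j}`), with `B• = D•` there, for realisations of a
type of a pair-flip CM field and a NONDEGENERATE type of ANY CM field whose orbit multiplicities on a homogeneous `O`
(compositum test off `O ∪ Ō`) are not constant-unequal — UNCONDITIONALLY. [cite: Gordon1999HodgeAVSurvey, 7.5 and 10.10] -/
theorem hodgeConjectureFor_prod_of_pairFlip_of_orbit (hI : ∀ i, i = i₀ ∨ i = i₁) (h01 : i₀ ≠ i₁)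
    (hflip₀ : ∀ x : K i₀ →+* ℂ, ∃ σ : ℂ ≃+* ℂ, σ • x = (starRingAut : ℂ ≃+* ℂ) • x ∧
      ∀ x' : K i₀ →+* ℂ, x' ≠ x → x' ≠ (starRingAut : ℂ ≃+* ℂ) • x → σ • x' = x')
    {x₀ : K i₀ →+* ℂ} (O : Set (K i₁ →+* ℂ)) (hO : ∀ y ∈ O, ∀ y' ∈ O, ∃ g : ℂ ≃+* ℂ, g • x₀ = x₀ ∧ g • y = y')
    (hoff : ∀ y : K i₁ →+* ℂ, y ∉ O → (starRingAut : ℂ ≃+* ℂ) • y ∉ O →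
      ∃ σ : ℂ ≃+* ℂ, σ • x₀ = (starRingAut : ℂ ≃+* ℂ) • x₀ ∧ σ • y = y)
    (hnd : IsNondegenerate (Φ i₁))
    (hnot : ¬ ∃ a b : ℕ, a ≠ b ∧ ∀ g : ℂ ≃+* ℂ,
      (Finset.univ.filter fun y : K i₁ →+* ℂ => y ∈ O ∧ g • y ∈ (Φ i₁).1).card = if g • x₀ ∈ (Φ i₀).1 then a else b)
    (hA : ∀ i, IsCMTypeRealisation (Φ i) (A i) (ι i) (θ i)) {N : ℕ} (π : Fin N → I) :
    HodgeConjectureFor (⨁ fun j : Fin N => A (π j)).dim (⨁ fun j : Fin N => A (π j)).X ∧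
      ∀ m : ℕ, hodgeClassSpan (⨁ fun j : Fin N => A (π j)).dim (⨁ fun j : Fin N => A (π j)).X m =
        divisorClassesSpan (⨁ fun j : Fin N => A (π j)).X (⨁ fun j : Fin N => A (π j)).dim m :=
  have h := (isNondegenerateFamily_iff_of_pairFlip_of_orbit hI h01 hflip₀ O hO hoff).2 ⟨hnd, hnot⟩
  ⟨h.hodgeConjectureFor_prod hA π, fun m => h.hodgeClassSpan_prod_eq_divisorClassesSpan hA π m⟩

/-- **`k` orbits, abelian varieties**: no orbit constants + `Φ₁` nondegenerate ⟹ HC with `B• = D•` on every `A₀^a × A₁^b`,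
UNCONDITIONALLY. [cite: Gordon1999HodgeAVSurvey, 7.5 and 10.10] -/
theorem hodgeConjectureFor_prod_of_pairFlip_of_not_exists_orbitCoeff (hI : ∀ i, i = i₀ ∨ i = i₁) (h01 : i₀ ≠ i₁)
    (hflip₀ : ∀ x : K i₀ →+* ℂ, ∃ σ : ℂ ≃+* ℂ, σ • x = (starRingAut : ℂ ≃+* ℂ) • x ∧
      ∀ x' : K i₀ →+* ℂ, x' ≠ x → x' ≠ (starRingAut : ℂ ≃+* ℂ) • x → σ • x' = x')
    {x₀ : K i₀ →+* ℂ} {κ : Type} [Fintype κ] (O : κ → Set (K i₁ →+* ℂ))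
    (hO : ∀ j, ∀ y ∈ O j, ∀ y' ∈ O j, ∃ g : ℂ ≃+* ℂ, g • x₀ = x₀ ∧ g • y = y')
    (hdisj : ∀ j j', j ≠ j' → ∀ y ∈ O j, y ∉ O j' ∧ (starRingAut : ℂ ≃+* ℂ) • y ∉ O j')
    (hoff : ∀ y : K i₁ →+* ℂ, (∀ j, y ∉ O j ∧ (starRingAut : ℂ ≃+* ℂ) • y ∉ O j) →
      ∃ σ : ℂ ≃+* ℂ, σ • x₀ = (starRingAut : ℂ ≃+* ℂ) • x₀ ∧ σ • y = y)
    (hnd : IsNondegenerate (Φ i₁))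
    (hnot : ¬ ∃ c : κ → ℚ, ∀ g : ℂ ≃+* ℂ, antiVec (Φ i₀).1 (1 : ℂ ≃+* ℂ) (g • x₀) =
      ∑ j, c j * ∑ y ∈ Finset.univ.filter (fun y : K i₁ →+* ℂ => y ∈ O j), antiVec (Φ i₁).1 (1 : ℂ ≃+* ℂ) (g • y))
    (hA : ∀ i, IsCMTypeRealisation (Φ i) (A i) (ι i) (θ i)) {N : ℕ} (π : Fin N → I) :
    HodgeConjectureFor (⨁ fun j : Fin N => A (π j)).dim (⨁ fun j : Fin N => A (π j)).X ∧
      ∀ m : ℕ, hodgeClassSpan (⨁ fun j : Fin N => A (π j)).dim (⨁ fun j : Fin N => A (π j)).X m =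
        divisorClassesSpan (⨁ fun j : Fin N => A (π j)).X (⨁ fun j : Fin N => A (π j)).dim m :=
  have h := (isNondegenerateFamily_iff_not_exists_orbitCoeff_of_pairFlip hI h01 hflip₀ O hO hdisj hoff).2 ⟨hnd, hnot⟩
  ⟨h.hodgeConjectureFor_prod hA π, fun m => h.hodgeClassSpan_prod_eq_divisorClassesSpan hA π m⟩

/-- **SIMPLE, NON-ISOGENOUS realisations, one orbit: `B• = D•` on ALL products `A₀^a × A₁^b` IFF `Φ₁` is nondegenerate
and its orbit multiplicities are not constant-unequal**; otherwise some product carries an exceptional Hodge class.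
[cite: Gordon1999HodgeAVSurvey, 7.5 and 7.6.1] -/
theorem forall_prod_hodgeClassSpan_eq_iff_of_pairFlip_of_orbit (hI : ∀ i, i = i₀ ∨ i = i₁) (h01 : i₀ ≠ i₁)
    (hflip₀ : ∀ x : K i₀ →+* ℂ, ∃ σ : ℂ ≃+* ℂ, σ • x = (starRingAut : ℂ ≃+* ℂ) • x ∧
      ∀ x' : K i₀ →+* ℂ, x' ≠ x → x' ≠ (starRingAut : ℂ ≃+* ℂ) • x → σ • x' = x')
    {x₀ : K i₀ →+* ℂ} (O : Set (K i₁ →+* ℂ)) (hO : ∀ y ∈ O, ∀ y' ∈ O, ∃ g : ℂ ≃+* ℂ, g • x₀ = x₀ ∧ g • y = y')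
    (hoff : ∀ y : K i₁ →+* ℂ, y ∉ O → (starRingAut : ℂ ≃+* ℂ) • y ∉ O →
      ∃ σ : ℂ ≃+* ℂ, σ • x₀ = (starRingAut : ℂ ≃+* ℂ) • x₀ ∧ σ • y = y)
    (hA : ∀ i, IsCMTypeRealisation (Φ i) (A i) (ι i) (θ i)) (hs : ∀ i, (A i).IsSimple)
    (hniso : ∀ i i', i ≠ i' → ¬ AbelianVariety.IsIsogenous (A i) (A i')) :
    (∀ (N : ℕ) (π : Fin N → I) (m : ℕ),
      hodgeClassSpan (⨁ fun j : Fin N => A (π j)).dim (⨁ fun j : Fin N => A (π j)).X m =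
        divisorClassesSpan (⨁ fun j : Fin N => A (π j)).X (⨁ fun j : Fin N => A (π j)).dim m) ↔
      IsNondegenerate (Φ i₁) ∧ ¬ ∃ a b : ℕ, a ≠ b ∧ ∀ g : ℂ ≃+* ℂ,
        (Finset.univ.filter fun y : K i₁ →+* ℂ => y ∈ O ∧ g • y ∈ (Φ i₁).1).card =
          if g • x₀ ∈ (Φ i₀).1 then a else b := by
  rw [← CMAlgebra.isNondegenerateFamily_iff_forall_prod_hodgeClassSpan_eq
    (CMAlgebra.isSeparatingFamily_of_isSimple_of_pairwise_not_isIsogenous hA hs hniso) hA]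
  exact isNondegenerateFamily_iff_of_pairFlip_of_orbit hI h01 hflip₀ O hO hoff

omit [DecidableEq I] in
/-- **Constant unequal orbit multiplicities on ANY set `O` put an exceptional Hodge class** — a rational `(m,m)`-class
outside `Dᵐ ⊗ ℂ` — **on some `A₀^a × A₁^b`** (simple, non-isogenous realisations; any two CM fields, no flip hypothesis).
[cite: Gordon1999HodgeAVSurvey, 7.5, 7.6.1 and 9.4.3] -/
theorem exists_exceptional_prod_of_orbitMultiplicities (h01 : i₀ ≠ i₁) {x₀ : K i₀ →+* ℂ} (O : Set (K i₁ →+* ℂ))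
    {a b : ℕ} (hab : a ≠ b)
    (hN : ∀ g : ℂ ≃+* ℂ, (Finset.univ.filter fun y : K i₁ →+* ℂ => y ∈ O ∧ g • y ∈ (Φ i₁).1).card =
      if g • x₀ ∈ (Φ i₀).1 then a else b)
    (hA : ∀ i, IsCMTypeRealisation (Φ i) (A i) (ι i) (θ i)) (hs : ∀ i, (A i).IsSimple)
    (hniso : ∀ i i', i ≠ i' → ¬ AbelianVariety.IsIsogenous (A i) (A i')) :
    ∃ (N : ℕ) (π : Fin N → I) (m : ℕ) (c : complexBetti (⨁ fun j : Fin N => A (π j)).X (2 * m)),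
      IsRationalClass c ∧
      IsOfHodgeType (⨁ fun j : Fin N => A (π j)).dim (⨁ fun j : Fin N => A (π j)).X (2 * m) m m c ∧
      c ∉ divisorClassesSpan (⨁ fun j : Fin N => A (π j)).X (⨁ fun j : Fin N => A (π j)).dim m :=
  CMAlgebra.exists_exceptional_prod_of_not_isNondegenerateFamily
    (CMAlgebra.isSeparatingFamily_of_isSimple_of_pairwise_not_isIsogenous hA hs hniso)
    (not_isNondegenerateFamily_of_orbitMultiplicities h01 O hab hN) hA

omit [DecidableEq I] in
/-- **Orbit constants (any sets `O_j`) put an exceptional Hodge class on some `A₀^a × A₁^b`** (simple, non-isogenous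
realisations). [cite: Gordon1999HodgeAVSurvey, 7.5 and 7.6.1] -/
theorem exists_exceptional_prod_of_orbitCoeff (h01 : i₀ ≠ i₁) {x₀ : K i₀ →+* ℂ} {κ : Type} [Fintype κ]
    (O : κ → Set (K i₁ →+* ℂ)) {c : κ → ℚ}
    (hc : ∀ g : ℂ ≃+* ℂ, antiVec (Φ i₀).1 (1 : ℂ ≃+* ℂ) (g • x₀) =
      ∑ j, c j * ∑ y ∈ Finset.univ.filter (fun y : K i₁ →+* ℂ => y ∈ O j), antiVec (Φ i₁).1 (1 : ℂ ≃+* ℂ) (g • y))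
    (hA : ∀ i, IsCMTypeRealisation (Φ i) (A i) (ι i) (θ i)) (hs : ∀ i, (A i).IsSimple)
    (hniso : ∀ i i', i ≠ i' → ¬ AbelianVariety.IsIsogenous (A i) (A i')) :
    ∃ (N : ℕ) (π : Fin N → I) (m : ℕ) (c : complexBetti (⨁ fun j : Fin N => A (π j)).X (2 * m)),
      IsRationalClass c ∧
      IsOfHodgeType (⨁ fun j : Fin N => A (π j)).dim (⨁ fun j : Fin N => A (π j)).X (2 * m) m m c ∧
      c ∉ divisorClassesSpan (⨁ fun j : Fin N => A (π j)).X (⨁ fun j : Fin N => A (π j)).dim m :=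
  CMAlgebra.exists_exceptional_prod_of_not_isNondegenerateFamily
    (CMAlgebra.isSeparatingFamily_of_isSimple_of_pairwise_not_isIsogenous hA hs hniso)
    (not_isNondegenerateFamily_of_orbitCoeff h01 O hc) hA

end Varieties

end Summit.HodgeConjecture.CorCM

end
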